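import Summits.KontsevichZagierPeriods.KontsevichZagierPeriods.Theses.HurwitzMicroSectors
import Summits.KontsevichZagierPeriods.KontsevichZagierPeriods.Theorems.HurwitzMicroSectorsNormalFormPrincipleIslandKernel
import Summits.KontsevichZagierPeriods.KontsevichZagierPeriods.Theorems.HurwitzMicroSectorsNormalFormPrinciplePiBoxTransfer
import Summits.KontsevichZagierPeriods.KontsevichZagierPeriods.Theorems.MzvKernelInKZ.Negative.ScalingDivision
import Literature.NumberTheory.Transcendental.KZKernelConjectureForms
import Literature.NumberTheory.Transcendental.KZVolumeConjectureProofs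

/-!
# Line `SectorLadder` — crux `NormalFormPrinciple` (stmt-KontsevichZagierPeriods-3869), G4 ladder-down

**Ladder top** `C = NormalFormPrinciple` (≡ the summit, `nfp_iff_statement`). **Rung family**
`SectorIsland E` (`E ≥ 1`): Conjecture 1 in KERNEL FORM on the weight-2 level-`q` SECTOR truncated at
height `E` — the subgroup generated by the box atoms
`[□², x₀^a x₁^b / ((q−x₀)^i (q−x₁)^j (q−x₀x₁)^m)]`, `a + b ≤ E − 1`, `i, j, m ≤ E`, on the open unit square —
conditional on the Viola–Zudilin rigidity hypothesis `Rig q` (ℚ-linear independence of `1, ℓ, L₂, ℓ²`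
stated on the integrals; a theorem in print for `q ≥ 9`, [ViolaZudilin2018, Thm 1]).
* FLOOR `E = 1` = the PRODUCT ISLAND of lead c9 (`island_mem_relations_of_eval_eq_zero`, landed
  2026-08-17): proved below as `sectorIsland_one` by inclusion of generators.
* NEXT RUNG `E = 2` (`SectorIslandTwo`), and the whole ladder `∀ E ≥ 1` (`sectorIsland_all`), from two
  transcendence-free DESCENT stubs (`stub_numeratorDescent`, `stub_poleDescent`: every new atom reduces,
  after an integer scaling, into the previous height modulo `KZ.relations`) — the rigidity input does NOT
  change along the ladder (all values stay in `ℚ⟨1, ℓ, Li₂(1/q), ℓ²⟩`, job j027295).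
* GAP `stub_ladderTop : (∀ E ≥ 1, SectorIsland E) → KZKernelConjecture` — summit-strength, flagged: the
  ladder exhausts one weight-2 sector at one level; the limit step is Conjecture 1 itself.
Composition `NormalFormPrinciple_of` concludes the crux BY NAME; sorries only in `stub_*`.
References: M. Kontsevich, D. Zagier, *Periods* (2001) §1.2; C. Viola, W. Zudilin, Linear independence of
dilogarithmic values, J. reine angew. Math. 736 (2018) 193–223 (arXiv:1405.6352 lineage; statement
quoted in arXiv:1912.03811 p.3); M. Kawashima, arXiv:2605.17756 Thm 2.2 (weight ≥ 3 inputs at level q).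
-/

noncomputable section

open MeasureTheory Set
open Literature.NumberTheory.Transcendental Literature.NumberTheory.Transcendental.KZ
open Summit.KontsevichZagierPeriods.MzvKernelInKZ.Negative (mem_relations_of_nsmul_mem)
open Summit.KontsevichZagierPeriods.HurwitzMicroSectors.NormalFormPrinciple.PiBox (normalFormPrinciple_of_statement)
open Summit.KontsevichZagierPeriods.HurwitzMicroSectors.NormalFormPrinciple.PiBox.Island (island_mem_relations_of_eval_eq_zero)

namespace Summit.KontsevichZagierPeriods.KontsevichZagierPeriods.Cruxes.NormalFormPrinciple.SectorLadder

/-- **Rigidity input at level `q`** (verbatim the hypothesis `hrig` of the product island): the only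
`ℚ`-linear relation among `1`, `ℓ = ∫₀¹dt/(q−t)`, `L₂ = ∫_□² dxdy/(q−xy)`, `ℓ²` is the trivial one.
A theorem for `q ≥ 9` (Viola–Zudilin 2018, Thm 1, with Landen). [cite: ViolaZudilin2018, Thm 1] -/
def Rig (q : ℕ) : Prop :=
  ∀ a b c d : ℚ,
    (a:ℝ) + b * (∫ t in Set.Ioo (0:ℝ) 1, 1 / ((q:ℝ) - t)) +
      c * (∫ x in {x : Fin 2 → ℝ | ∀ i, x i ∈ Set.Ioo (0:ℝ) 1}, 1 / ((q:ℝ) - x 0 * x 1)) +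
      d * (∫ t in Set.Ioo (0:ℝ) 1, 1 / ((q:ℝ) - t)) ^ 2 = 0 → a = 0 ∧ b = 0 ∧ c = 0 ∧ d = 0

/-- **Generators of the weight-2 level-`q` sector** with numerator degree `≤ A`, linear multiplicities
`≤ P` and hyperbolic multiplicity `≤ M`: the classes `[□², x₀^a x₁^b/((q−x₀)^i (q−x₁)^j (q−x₀x₁)^m)]`
on the open unit square. [cite: KontsevichZagier2001, §1.1] -/
def gens (A P M q : ℕ) : Set FormalRep :=
  {y | ∃ (N : IntegralRep 2) (a b i j m : ℕ), a + b ≤ A ∧ i ≤ P ∧ j ≤ P ∧ m ≤ M ∧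
      N.domain = {x | ∀ i, x i ∈ Set.Ioo (0:ℝ) 1} ∧
      EqOn N.integrand (fun x => x 0 ^ a * x 1 ^ b /
        (((q:ℝ) - x 0) ^ i * ((q:ℝ) - x 1) ^ j * ((q:ℝ) - x 0 * x 1) ^ m)) N.domain ∧
      y = of N}

/-- **RUNG `SectorIsland E`**: Conjecture 1 in kernel form, modulo `Rig q`, on the sector truncated at
height `E` (numerators of degree `≤ E − 1`, all three multiplicities `≤ E`), for every level `q ≥ 2`.
`E = 1` is the product island (floor); the ladder is `E = 1, 2, 3, …`. [cite: KontsevichZagier2001, §1.2 Conjecture 1] -/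
def SectorIsland (E : ℕ) : Prop :=
  ∀ q : ℕ, 2 ≤ q → Rig q →
    ∀ c ∈ AddSubgroup.closure (gens (E - 1) E E q), eval c = 0 → c ∈ relations

/-- The rung one parameter above the floor (`θ₁ = 2`), as a constant for the probes. -/
def SectorIslandTwo : Prop := SectorIsland 2

/-- The ladder's limit `Rung∞`. -/
def SectorIslandAll : Prop := ∀ E : ℕ, 1 ≤ E → SectorIsland E

/-- The eight product-island generator sets of lead c9, verbatim (so that `AddSubgroup.closure_mono`
meets `island_mem_relations_of_eval_eq_zero` definitionally). [cite: KontsevichZagier2001, §1.1] -/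
def islandGens (q : ℕ) : Set FormalRep :=
  ({y : FormalRep | ∃ N : IntegralRep 2, N.domain = {x | ∀ i, x i ∈ Set.Ioo (0:ℝ) 1} ∧
      EqOn N.integrand (fun _ => (1:ℝ)) N.domain ∧ y = of N} ∪
   {y : FormalRep | ∃ N : IntegralRep 2, N.domain = {x | ∀ i, x i ∈ Set.Ioo (0:ℝ) 1} ∧
      EqOn N.integrand (fun x => 1 / ((q:ℝ) - x 0)) N.domain ∧ y = of N} ∪
   {y : FormalRep | ∃ N : IntegralRep 2, N.domain = {x | ∀ i, x i ∈ Set.Ioo (0:ℝ) 1} ∧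
      EqOn N.integrand (fun x => 1 / ((q:ℝ) - x 1)) N.domain ∧ y = of N} ∪
   {y : FormalRep | ∃ N : IntegralRep 2, N.domain = {x | ∀ i, x i ∈ Set.Ioo (0:ℝ) 1} ∧
      EqOn N.integrand (fun x => 1 / ((q:ℝ) - x 0 * x 1)) N.domain ∧ y = of N} ∪
   {y : FormalRep | ∃ N : IntegralRep 2, N.domain = {x | ∀ i, x i ∈ Set.Ioo (0:ℝ) 1} ∧
      EqOn N.integrand (fun x => 1 / (((q:ℝ) - x 0) * ((q:ℝ) - x 1))) N.domain ∧ y = of N} ∪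
   {y : FormalRep | ∃ N : IntegralRep 2, N.domain = {x | ∀ i, x i ∈ Set.Ioo (0:ℝ) 1} ∧
      EqOn N.integrand (fun x => 1 / (((q:ℝ) - x 0) * ((q:ℝ) - x 0 * x 1))) N.domain ∧ y = of N} ∪
   {y : FormalRep | ∃ N : IntegralRep 2, N.domain = {x | ∀ i, x i ∈ Set.Ioo (0:ℝ) 1} ∧
      EqOn N.integrand (fun x => 1 / (((q:ℝ) - x 1) * ((q:ℝ) - x 0 * x 1))) N.domain ∧ y = of N} ∪
   {y : FormalRep | ∃ N : IntegralRep 2, N.domain = {x | ∀ i, x i ∈ Set.Ioo (0:ℝ) 1} ∧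
      EqOn N.integrand (fun x => 1 / (((q:ℝ) - x 0) * ((q:ℝ) - x 1) * ((q:ℝ) - x 0 * x 1))) N.domain ∧ y = of N})

/-- **Floor inclusion**: at height `1` the sector generators are (pointwise the same functions as) the
eight island atoms. [cite: KontsevichZagier2001, §1.1] -/
theorem gens_one_subset_islandGens (q : ℕ) : gens 0 1 1 q ⊆ islandGens q := by
  rintro y ⟨N, a, b, i, j, m, hab, hi, hj, hm, hd, hf, rfl⟩
  obtain ⟨rfl, rfl⟩ : a = 0 ∧ b = 0 := ⟨by omega, by omega⟩
  simp only [islandGens, Set.mem_union, Set.mem_setOf_eq]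
  interval_cases i <;> interval_cases j <;> interval_cases m
  · exact Or.inl <| Or.inl <| Or.inl <| Or.inl <| Or.inl <| Or.inl <| Or.inl
      ⟨N, hd, fun x hx => by rw [hf hx]; simp, rfl⟩
  · exact Or.inl <| Or.inl <| Or.inl <| Or.inl <| Or.inr
      ⟨N, hd, fun x hx => by rw [hf hx]; simp, rfl⟩
  · exact Or.inl <| Or.inl <| Or.inl <| Or.inl <| Or.inl <| Or.inr
      ⟨N, hd, fun x hx => by rw [hf hx]; simp, rfl⟩
  · exact Or.inl <| Or.inr
      ⟨N, hd, fun x hx => by rw [hf hx]; simp, rfl⟩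
  · exact Or.inl <| Or.inl <| Or.inl <| Or.inl <| Or.inl <| Or.inl <| Or.inr
      ⟨N, hd, fun x hx => by rw [hf hx]; simp, rfl⟩
  · exact Or.inl <| Or.inl <| Or.inr
      ⟨N, hd, fun x hx => by rw [hf hx]; simp, rfl⟩
  · exact Or.inl <| Or.inl <| Or.inl <| Or.inr
      ⟨N, hd, fun x hx => by rw [hf hx]; simp, rfl⟩
  · exact Or.inr
      ⟨N, hd, fun x hx => by rw [hf hx]; simp [mul_assoc], rfl⟩

/-- **FLOOR of the ladder (`E = 1`) = the product island of lead c9** — a tree theorem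
(`island_mem_relations_of_eval_eq_zero`, 2026-08-17), by monotonicity of the generated subgroup.
[cite: KontsevichZagier2001, §1.2 Conjecture 1] [cite: ViolaZudilin2018, Thm 1] -/
theorem sectorIsland_one : SectorIsland 1 := fun q hq hrig _ hc hv =>
  island_mem_relations_of_eval_eq_zero q hq hrig
    (AddSubgroup.closure_mono (gens_one_subset_islandGens q) hc) hv

/-- **On-path record (`S → Rung`)**: every rung is a consequence of the summit (Conjecture 1 in
kernel form gives the kernel statement on any subgroup, for any `E`). [cite: KontsevichZagier2001, §1.2 Conjecture 1] -/
theorem sectorIsland_of_statement (h : _root_.KontsevichZagierPeriods) (E : ℕ) : SectorIsland E :=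
  fun _ _ _ c _ hv => (kzKernelConjecture_iff_isRational.mpr (KontsevichZagierPeriods_iff.mp h)) c hv

/-! ## The ladder: two transcendence-free descent stubs, the induction, and the gap -/

/-- `A` REDUCES INTO `B`: every element of the subgroup generated by `A` is, after a positive integer
scaling, congruent modulo `KZ.relations` to an element of the subgroup generated by `B`. -/
def ReducesInto (A B : Set FormalRep) : Prop :=
  ∀ c ∈ AddSubgroup.closure A, ∃ k : ℕ, 0 < k ∧ ∃ c' ∈ AddSubgroup.closure B, k • c - c' ∈ relations

/-- Kernel statements transfer backwards along a reduction (soundness `relations ≤ ker eval` and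
division by positive integers in `FormalRep ⧸ relations`). [cite: KontsevichZagier2001, §1.2] -/
theorem kernel_of_reducesInto {A B : Set FormalRep} (h : ReducesInto A B)
    (hB : ∀ c ∈ AddSubgroup.closure B, eval c = 0 → c ∈ relations) :
    ∀ c ∈ AddSubgroup.closure A, eval c = 0 → c ∈ relations := by
  intro c hc hv
  obtain ⟨k, hk, c', hc', hrel⟩ := h c hc
  have hv' : eval c' = 0 := by
    have h0 : eval (k • c - c') = 0 := eval_eq_zero_of_mem_relations hrel
    rwa [map_sub, map_nsmul, hv, smul_zero, zero_sub, neg_eq_zero] at h0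
  have hkc : k • c ∈ relations := by
    have := relations.add_mem hrel (hB c' hc' hv')
    simpa using this
  exact mem_relations_of_nsmul_mem hk hkc

/-- **STUB (M) — numerator descent.** At linear/hyperbolic multiplicities `≤ E+1`, every atom with a
monomial numerator of degree `≤ E` reduces (with scaling) into the constant-numerator atoms of the same
multiplicities: torus exactness `(a−b)·x₀^a x₁^b h(x₀x₁) = ∂₀(x₀·) − ∂₁(x₁·)`, the substitution
`x₀ = q − (q − x₀)` against a linear letter, and — when a linear letter in the OTHER variable is
present — a genuinely two-dimensional chain (chart `(x₀, x₀x₁)` onto the triangle, as in `isl_chart_W`).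
Why it might fail: the mixed case `x₀^a/((q−x₁)^j (q−x₀x₁)^m)` has no one-variable primitive inside the
class; each pattern needs its own Stokes chain. [cite: KontsevichZagier2001, §1.2] -/
theorem stub_numeratorDescent :
    ∀ E q : ℕ, 1 ≤ E → 2 ≤ q → ReducesInto (gens E (E + 1) (E + 1) q) (gens 0 (E + 1) (E + 1) q) := by
  sorry

/-- **STUB (L−) — pole descent (the located stop of the method).** Constant-numerator atoms with
multiplicities `≤ E+1` reduce (with scaling by a positive integer, denominators `q^α (q−1)^β`) into the
sector of height `E`. For a single letter this is Euler's descent / integration by parts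
(`q(q−1)·[1/(q−x₀)²] ≡ [1]`, `q·[1/(q−x₀x₁)²] ≡ [1/(q−x₀)]`); with a linear AND the hyperbolic letter
present, partial fractions across `q − x₁` and `q − x₀x₁` produce the boundary-singular factor
`1/(q(1−x₀))` and leave the class, so the descent must be a move chain in dimension two or three
(rule 1b splits, the chart onto the triangle, dissections) found pattern by pattern — no uniform
recursion is known (integration by parts RAISES the hyperbolic order). Values stay in
`ℚ⟨1, ℓ, Li₂(1/q), ℓ²⟩` for all multiplicities (certified numerically, job j027295), so no new
rigidity input is needed. Why it might fail: only through the size of the chains; the statement is an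
instance of Conjecture 1. [cite: KontsevichZagier2001, §1.2] -/
theorem stub_poleDescent :
    ∀ E q : ℕ, 1 ≤ E → 2 ≤ q → ReducesInto (gens 0 (E + 1) (E + 1) q) (gens (E - 1) E E q) := by
  sorry

/-- **One step up the ladder**, from the two descent statements taken as hypotheses. -/
theorem sectorIsland_succ_of
    (hM : ∀ E q : ℕ, 1 ≤ E → 2 ≤ q → ReducesInto (gens E (E + 1) (E + 1) q) (gens 0 (E + 1) (E + 1) q))
    (hL : ∀ E q : ℕ, 1 ≤ E → 2 ≤ q → ReducesInto (gens 0 (E + 1) (E + 1) q) (gens (E - 1) E E q))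
    (E : ℕ) (hE : 1 ≤ E) (h : SectorIsland E) : SectorIsland (E + 1) := by
  intro q hq hrig
  have h1 := kernel_of_reducesInto (hL E q hE hq) (h q hq hrig)
  have h2 := kernel_of_reducesInto (hM E q hE hq) h1
  simpa using h2

/-- **The whole ladder from the floor**, by induction (`Nat.le_induction`) from `sectorIsland_one`
(the landed product island), the descent statements taken as hypotheses. -/
theorem sectorIsland_all_of
    (hM : ∀ E q : ℕ, 1 ≤ E → 2 ≤ q → ReducesInto (gens E (E + 1) (E + 1) q) (gens 0 (E + 1) (E + 1) q))
    (hL : ∀ E q : ℕ, 1 ≤ E → 2 ≤ q → ReducesInto (gens 0 (E + 1) (E + 1) q) (gens (E - 1) E E q)) :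
    SectorIslandAll := by
  intro E hE
  induction E, hE using Nat.le_induction with
  | base => exact sectorIsland_one
  | succ E hE ih => exact sectorIsland_succ_of hM hL E hE ih

/-- One step up the ladder (modulo the two descent stubs). -/
theorem sectorIsland_succ (E : ℕ) (hE : 1 ≤ E) (h : SectorIsland E) : SectorIsland (E + 1) :=
  sectorIsland_succ_of stub_numeratorDescent stub_poleDescent E hE h

/-- **The whole ladder** `∀ E ≥ 1, SectorIsland E` — modulo the two descent stubs only. -/
theorem sectorIsland_all : SectorIslandAll := sectorIsland_all_of stub_numeratorDescent stub_poleDescent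

/-- **NEXT RUNG `θ₁ = 2`**: the sector of height two (numerators `x₀, x₁`; all multiplicities `≤ 2`). -/
theorem sectorIslandTwo_of : SectorIslandTwo := sectorIsland_all 2 (by norm_num)

/-- **STUB (summit-strength GAP, flagged honestly).** The ladder exhausts ONE weight-2 sector at ONE
level `q` (values in a 4-dimensional `ℚ`-space); Conjecture 1 in kernel form for ALL formal
combinations does not follow from any number of such rungs — the limit step is "all sectors, all
levels, all weights, and the joins between them", i.e. the period conjecture. Next axes with a
PRINTED rigidity input: weight `w ≥ 3` at level `q ≥ q₀(w)` (Kawashima 2026, Thm 2.2 with `m = 1`: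
`1` and the `2^w − 1` one-variable multiple polylogarithms of weight `≤ w` at `1/q` are `ℚ`-linearly
independent for `log q > w·2^w + (2^w − 1 + w(w+1)/2)·log 2`). [cite: KontsevichZagier2001, §1.2 Conjecture 1] -/
theorem stub_ladderTop : SectorIslandAll → KZKernelConjecture := by
  sorry

/-- **Composition — the crux BY NAME** (type literally the route decl), from the registered stubs
`stub_numeratorDescent`, `stub_poleDescent` (through `sectorIsland_all_of` and the floor `sectorIsland_one`)
and the gap stub `stub_ladderTop`, via the tree equivalences `kzKernelConjecture_iff_isRational`,
`KontsevichZagierPeriods_iff`, `normalFormPrinciple_of_statement`. -/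
theorem NormalFormPrinciple_of :
    Summit.KontsevichZagierPeriods.KontsevichZagierPeriods.Theses.HurwitzMicroSectors.NormalFormPrinciple :=
  normalFormPrinciple_of_statement
    (KontsevichZagierPeriods_iff.mpr (kzKernelConjecture_iff_isRational.mp
      (stub_ladderTop (sectorIsland_all_of stub_numeratorDescent stub_poleDescent))))

end Summit.KontsevichZagierPeriods.KontsevichZagierPeriods.Cruxes.NormalFormPrinciple.SectorLadder
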